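import Literature.MathematicalPhysics.KineticTheory.CollisionTubeDecoratedSumVariance
import HarnessLib

/-!
# The collision-tube functional at rung 0: the static variance bound, modulo the decorated
# pair-pair decorrelation of the canonical hard-sphere measure

Topic `Literature/MathematicalPhysics/KineticTheory` (kind proof; the variance (hA)₀ of the TUBE side of
the Enskog closure at rung 0, crux line `even-rung-mean-variance` of `JParityClosure.EvenStressEnskog`,
stmt-AtomisticToContinuum-13079).  Constant profiles `(a, u, θ)`, `N + 1` spheres of diameter
`ε = ε_N` on `𝕋³`, rung-0 law `G_N = zipConfig_# (P_N ⊗ ⊗ᵢ N(u, θ))` (`HardSphereUniformGas`;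
`P_N = posGibbsMeasure 1 ε (N+1)`), and the collision-tube functional at truncation level `1`,
`A_t = ((N+1)κ)⁻¹ Σ_{i≠j} χ(t, xᵢ) g(σ³ρ̃_r(x, xᵢ)) M_{ij}`, `M_{ij} = pairTubeMark ε κ Ξ_L i j x v`
(`tubeStat_zipConfig_eq`).  `variance_tubeStat_rung0_le` bounds `Var_{G_N}(A_t)` by four terms,

  `K₁/(N+1) + K₂ ζ + K₃ ζ'² + K₄ P_N(Bad_N(δ, r))`,

with constants depending only on `(L, κ, C_χ, C_g, σ)`, GIVEN the decorated pair-pair decorrelation of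
`P_N` for indicators at level `ζ` (hypothesis `hdec`, four distinct labels, weight `h = χ(t, ·)/C_χ`) and a
continuity modulus `ζ'` of `g` at `σ³` on the `δ`-neighbourhood of `1` (hypothesis `hmod`):

1. `A_t ∘ zipConfig = c₁ S + R` with `c₁ = ((N+1)κ)⁻¹ g(σ³) C_χ`, `S = Σ_{i≠j} h(xᵢ) M_{ij}` the decorated
   tube sum (`variance_prod_decoratedTubeSum_le` of `CollisionTubeDecoratedSumVariance`), and the
   density-weight remainder `|R| ≤ (2 L C_χ C_p/κ)(ζ' + 2C_g 𝟙_{Bad})` on the hard core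
   (`C_p = (3 + 4Lκ)³`, packing `shellCount_le_cube`; uniform density LLN off `Bad`,
   `abs_empDensity_sub_one_lt_of_not_mem`), so `Var(R) ≤ E R² ≤ (2 L C_χ C_p/κ)² (2ζ'² + 8C_g² P_N(Bad))`;
2. `Var ≤ 2 c₁² Var(S) + 2 Var(R)` and the transfer `Var_{G_N}(A_t) = Var_{P_N ⊗ Q}(A_t ∘ zipConfig)`
   (`variance_localGibbsLaw_rung0_eq`); `(N+1) ε³ = σ³` converts the shell volumes.

References: C. Cercignani, R. Illner, M. Pulvirenti (1994) §2.2 [CIPDiluteGases1994]; D. Ruelle (1969)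
§4.2 [Ruelle1969]; H. Spohn (1991) Part I §2.3 [Spohn1991].
-/

noncomputable section

namespace Literature.MathematicalPhysics.KineticTheory

open MeasureTheory ProbabilityTheory Set Filter Function
open scoped ENNReal InnerProductSpace BigOperators
open Literature.Analysis.FluidPDE Literature.Probability.Moments

/-! ## The static variance bound -/

/-- **The static tube variance at rung 0, modulo the decorated pair-pair decorrelation.**  Small reduced
density, constant profiles `a, θ > 0`, `u`, `N ≥ 1`, continuous `χ` with `|χ(t, ·)| ≤ C_χ` (`C_χ > 0`),
continuous `g` with `|g| ≤ C_g` on `[0, ∞)` and modulus `|g(σ³y) − g(σ³)| ≤ ζ'` for `y ≥ 0`, `|y − 1| < δ`,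
`L > 0`, `κ > 0`, `r > 0`, `ε(1 + 2Lκ) < 1/2`, and the decorated pair-pair decorrelation bound of `P_N` for
indicators at level `ζ ≥ 0` with weight `χ(t, ·)/C_χ` (hypothesis `hdec`).  Then, with
`C_p = (3 + 4Lκ)³`, `V_L = (4π/3)(1 + 2Lκ)³`, `B = 2L`,
`Var_{G_N}(A_t) ≤ 2 (C_g C_χ/κ)² ((64 L² C_p² + 32 B² V_L σ³ + 192 B² V_L² σ⁶)/(N+1) + 8 ζ B² V_L² σ⁶)
  + 2 (2 L C_χ C_p/κ)² (2 ζ'² + 8 C_g² P_N(Bad_N(δ, r)))`. [folklore] -/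
theorem variance_tubeStat_rung0_le {σ : ℝ} (hsd : SmallDensity uniformProfile σ) {a θ : ℝ} (ha : 0 < a)
    (hθ : 0 < θ) (u : V3) {N : ℕ} (hN : 1 ≤ N)
    (Φ : HardSphereFlow (Torus.geometry (Fin 3)) (hsDiameter σ N) (N + 1))
    {χ : ℝ × UnitAddTorus (Fin 3) → ℝ} (hχ : Continuous χ) {Cχ : ℝ} (hCχ : 0 < Cχ) (t : ℝ)
    (hχb : ∀ y, |χ (t, y)| ≤ Cχ) {g : ℝ → ℝ} (hg : Continuous g) {Cg : ℝ} (hCg : ∀ y, 0 ≤ y → |g y| ≤ Cg)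
    (k l : Fin 3) {L κ r : ℝ} (hL : 0 < L) (hκ : 0 < κ) (hr : 0 < r)
    (hεL : hsDiameter σ N * (1 + 2 * L * κ) < 1 / 2) {ζ : ℝ} (hζ : 0 ≤ ζ)
    (hdec : ∀ i j i' j' : Fin (N + 1), i ≠ j → i ≠ i' → i ≠ j' → j ≠ i' → j ≠ j' → i' ≠ j' →
      ∀ T T' : Set T3, MeasurableSet T → MeasurableSet T' →
      |(∫ x, χ (t, x i) / Cχ * T.indicator (fun _ => (1 : ℝ)) (x j - x i) *
          (χ (t, x i') / Cχ * T'.indicator (fun _ => (1 : ℝ)) (x j' - x i'))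
          ∂posGibbsMeasure (fun _ : T3 => (1 : ℝ)) (hsDiameter σ N) (N + 1)) -
        (∫ x, χ (t, x i) / Cχ * T.indicator (fun _ => (1 : ℝ)) (x j - x i)
          ∂posGibbsMeasure (fun _ : T3 => (1 : ℝ)) (hsDiameter σ N) (N + 1)) *
        (∫ x, χ (t, x i') / Cχ * T'.indicator (fun _ => (1 : ℝ)) (x j' - x i')
          ∂posGibbsMeasure (fun _ : T3 => (1 : ℝ)) (hsDiameter σ N) (N + 1))|
        ≤ ζ * (volume T).toReal * (volume T').toReal)
    {ζ' δ : ℝ} (hζ' : 0 ≤ ζ') (hδ : 0 < δ)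
    (hmod : ∀ y, 0 ≤ y → |y - 1| < δ → |g (σ ^ 3 * y) - g (σ ^ 3)| ≤ ζ') :
    variance (fun z => tubeStat σ N χ g (evenMarkTrunc k l L) r r 1 κ t z)
        (localGibbsLaw σ (fun _ => a) (fun _ => u) (fun _ => θ) N Φ) ≤
      2 * (Cg * Cχ / κ) ^ 2 *
          ((64 * L ^ 2 * ((3 + 4 * L * κ) ^ 3) ^ 2 + 32 * (2 * L) ^ 2 * (4 / 3 * Real.pi * (1 + 2 * L * κ) ^ 3) * σ ^ 3 +
              192 * (2 * L) ^ 2 * (4 / 3 * Real.pi * (1 + 2 * L * κ) ^ 3) ^ 2 * σ ^ 6) / (N + 1 : ℕ) +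
            8 * ζ * (2 * L) ^ 2 * (4 / 3 * Real.pi * (1 + 2 * L * κ) ^ 3) ^ 2 * σ ^ 6) +
        2 * (2 * L * Cχ * (3 + 4 * L * κ) ^ 3 / κ) ^ 2 * (2 * ζ' ^ 2 + 8 * Cg ^ 2 *
          (posGibbsMeasure (fun _ : T3 => (1 : ℝ)) (hsDiameter σ N) (N + 1)).real (sqDevEvent (N + 1) δ r)) := by
  have hσ := hsd.σ_pos
  have hε := hsDiameter_pos hσ N
  haveI := isProbabilityMeasure_posGibbsMeasure continuous_const (fun _ => one_pos) hsd.σ_lt_half.le N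
  set P := posGibbsMeasure (fun _ : T3 => (1 : ℝ)) (hsDiameter σ N) (N + 1) with hP
  set Q : Measure (Fin (N + 1) → V3) := Measure.pi fun _ : Fin (N + 1) => gaussMeasure u θ with hQ
  set Ξ := evenMarkTrunc k l L with hΞ
  have hΞm : Measurable Ξ := (continuous_evenMarkTrunc k l L).measurable
  set Cp : ℝ := (3 + 4 * L * κ) ^ 3 with hCp
  set n : ℝ := ((N + 1 : ℕ) : ℝ) with hn
  have hn0 : 0 < n := by rw [hn]; positivity
  have hn' : (N + 1 : ℝ) = n := by rw [hn]; push_cast; ring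
  set c₀ : ℝ := (n * κ)⁻¹ with hc₀
  have hc₀0 : 0 ≤ c₀ := by positivity
  -- the weight `h = χ(t, ·)/C_χ`
  set h : T3 → ℝ := fun y => χ (t, y) / Cχ with hh
  have hhm : Measurable h := (hχ.comp (Continuous.prodMk_right t)).measurable.div_const _
  have hh1 : ∀ y, |h y| ≤ 1 := fun y => by
    rw [hh]; dsimp only; rw [abs_div, abs_of_pos hCχ, div_le_one hCχ]; exact hχb y
  -- the three functions on the product space
  set A' : (Fin (N + 1) → T3) × (Fin (N + 1) → V3) → ℝ := fun p => tubeStat σ N χ g Ξ r r 1 κ t (zipConfig p)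
    with hA'
  set S : (Fin (N + 1) → T3) × (Fin (N + 1) → V3) → ℝ := fun p =>
    ∑ i, ∑ j, if i ≠ j then h (p.1 i) * pairTubeMark (hsDiameter σ N) κ Ξ i j p.1 p.2 else 0 with hS
  set c₁ : ℝ := c₀ * g (σ ^ 3) * Cχ with hc₁
  set R : (Fin (N + 1) → T3) × (Fin (N + 1) → V3) → ℝ := fun p => A' p - c₁ * S p with hR
  set M : (Fin (N + 1) → T3) × (Fin (N + 1) → V3) → Fin (N + 1) → Fin (N + 1) → ℝ :=
    fun p i j => pairTubeMark (hsDiameter σ N) κ Ξ i j p.1 p.2 with hM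
  -- formulas
  have hA'eq : ∀ p, A' p = c₀ * ∑ i, ∑ j,
      (if i ≠ j then χ (t, p.1 i) * g (σ ^ 3 * empDensity r p.1 (p.1 i)) * M p i j else 0) := fun p => by
    rw [hA', hc₀, ← hn']
    exact tubeStat_zipConfig_eq hσ N χ g k l hL.le r κ t p.1 p.2
  have hSeq : ∀ p, c₁ * S p = c₀ * ∑ i, ∑ j, (if i ≠ j then χ (t, p.1 i) * g (σ ^ 3) * M p i j else 0) := fun p => by
    rw [hS, hc₁]
    dsimp only
    rw [Finset.mul_sum, Finset.mul_sum]
    refine Finset.sum_congr rfl fun i _ => ?_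
    rw [Finset.mul_sum, Finset.mul_sum]
    refine Finset.sum_congr rfl fun j _ => ?_
    split_ifs
    · rw [hh]; dsimp only; field_simp; try ring
    · rw [mul_zero, mul_zero]
  have hReq : ∀ p, R p = c₀ * ∑ i, ∑ j,
      (if i ≠ j then χ (t, p.1 i) * (g (σ ^ 3 * empDensity r p.1 (p.1 i)) - g (σ ^ 3)) * M p i j else 0) := by
    intro p
    rw [hR]; dsimp only
    rw [hA'eq p, hSeq p, ← mul_sub, ← Finset.sum_sub_distrib]
    congr 1
    refine Finset.sum_congr rfl fun i _ => ?_
    rw [← Finset.sum_sub_distrib]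
    refine Finset.sum_congr rfl fun j _ => ?_
    split_ifs <;> ring
  -- measurability
  have hterm_m : ∀ i j, Measurable fun p : (Fin (N + 1) → T3) × (Fin (N + 1) → V3) =>
      (if i ≠ j then χ (t, p.1 i) * g (σ ^ 3 * empDensity r p.1 (p.1 i)) * M p i j else 0) := by
    intro i j
    by_cases hij : i ≠ j
    · simp only [if_pos hij, hM]
      have h0 : Measurable fun x : Fin (N + 1) → T3 => (x, x i) := measurable_id.prodMk (measurable_pi_apply i)
      have h1 := (measurable_empDensity r).comp h0
      have h2 : Measurable fun p : (Fin (N + 1) → T3) × (Fin (N + 1) → V3) =>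
          g (σ ^ 3 * empDensity r p.1 (p.1 i)) := hg.measurable.comp ((h1.comp measurable_fst).const_mul _)
      have h3 : Measurable fun p : (Fin (N + 1) → T3) × (Fin (N + 1) → V3) => χ (t, p.1 i) :=
        (hχ.comp (Continuous.prodMk_right t)).measurable.comp ((measurable_pi_apply i).comp measurable_fst)
      exact (h3.mul h2).mul (measurable_pairTubeMark (hsDiameter σ N) κ hΞm i j)
    · simp only [if_neg hij]; exact measurable_const
  have hA'm : Measurable A' := by
    rw [show A' = fun p => c₀ * ∑ i, ∑ j,
      (if i ≠ j then χ (t, p.1 i) * g (σ ^ 3 * empDensity r p.1 (p.1 i)) * M p i j else 0) from funext hA'eq]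
    exact (Finset.measurable_sum _ fun i _ => Finset.measurable_sum _ fun j _ => hterm_m i j).const_mul _
  have hSm : Measurable S := measurable_decoratedTubeSum (hsDiameter σ N) κ hΞm hhm
  -- boundedness and `L²`
  have hMb : ∀ p i j, |M p i j| ≤ 2 * L := fun p i j => abs_pairTubeMark_le _ κ (abs_evenMarkTrunc_le k l hL.le) i j _ _
  have hCg0 : 0 ≤ Cg := (abs_nonneg _).trans (hCg 0 le_rfl)
  have hρ0 : ∀ (x : Fin (N + 1) → T3) y, 0 ≤ empDensity r x y := fun x y => (empDensity_mem_Icc hr x y).1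
  have hsum2 : ∀ {f : Fin (N + 1) → Fin (N + 1) → ℝ} {C : ℝ}, (∀ i j, |f i j| ≤ C) →
      |∑ i, ∑ j, f i j| ≤ n * (n * C) := fun {f C} hf => by
    refine (Finset.abs_sum_le_sum_abs _ _).trans ?_
    calc ∑ i, |∑ j, f i j| ≤ ∑ _i : Fin (N + 1), (n * C) := Finset.sum_le_sum fun i _ =>
          (Finset.abs_sum_le_sum_abs _ _).trans ((Finset.sum_le_sum fun j _ => hf i j).trans (by
            rw [Finset.sum_const, Finset.card_univ, Fintype.card_fin, nsmul_eq_mul]))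
      _ = n * (n * C) := by rw [Finset.sum_const, Finset.card_univ, Fintype.card_fin, nsmul_eq_mul]
  have hA'b : ∀ p, |A' p| ≤ c₀ * (n * (n * (Cχ * Cg * (2 * L)))) := fun p => by
    rw [hA'eq p, abs_mul, abs_of_nonneg hc₀0]
    refine mul_le_mul_of_nonneg_left (hsum2 fun i j => ?_) hc₀0
    split_ifs
    · rw [abs_mul, abs_mul]
      exact mul_le_mul (mul_le_mul (hχb _) (hCg _ (mul_nonneg (by positivity) (hρ0 _ _))) (abs_nonneg _)
        hCχ.le) (hMb p i j) (abs_nonneg _) (mul_nonneg hCχ.le hCg0)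
    · rw [abs_zero]; positivity
  have hSb : ∀ p, |S p| ≤ n * (n * (2 * L)) := fun p => hsum2 fun i j => by
    split_ifs
    · rw [abs_mul]; exact (mul_le_mul (hh1 _) (hMb p i j) (abs_nonneg _) zero_le_one).trans_eq (one_mul _)
    · rw [abs_zero]; linarith
  have hA'2 : MemLp A' 2 (P.prod Q) := memLp_two_of_abs_le' hA'm hA'b
  have hS2 : MemLp (fun p => c₁ * S p) 2 (P.prod Q) := (memLp_two_of_abs_le' hSm hSb).const_mul c₁
  have hR2 : MemLp R 2 (P.prod Q) := hA'2.sub hS2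
  have hRm : Measurable R := hA'm.sub (hSm.const_mul c₁)
  -- (1) the split `Var A' ≤ 2 c₁² Var S + 2 Var R`
  have hsplit : variance A' (P.prod Q) ≤ 2 * (c₁ ^ 2 * variance S (P.prod Q)) + 2 * variance R (P.prod Q) := by
    have e : A' = fun p => c₁ * S p + R p := by funext p; rw [hR]; ring
    rw [e, ← variance_const_mul]
    exact variance_add_le_two_mul hS2 hR2
  -- (2) the decorated tube sum
  have hVarS := variance_prod_decoratedTubeSum_le hsd hN k l hL hκ.le hεL hhm hh1 (gaussMeasure u θ) hζ hdec
  -- (3) the density-weight remainder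
  set Bad : Set (Fin (N + 1) → T3) := sqDevEvent (N + 1) δ r with hBad
  have hBadm : MeasurableSet Bad := measurableSet_sqDevEvent (N + 1) δ r
  set Dx : (Fin (N + 1) → T3) → ℝ := fun x => ζ' + 2 * Cg * Bad.indicator (fun _ => (1 : ℝ)) x with hDx
  have hDle : ∀ (x : Fin (N + 1) → T3) i, |g (σ ^ 3 * empDensity r x (x i)) - g (σ ^ 3)| ≤ Dx x := by
    intro x i
    by_cases hx : x ∈ Bad
    · rw [hDx]; dsimp only; rw [indicator_of_mem hx, mul_one]
      calc |g (σ ^ 3 * empDensity r x (x i)) - g (σ ^ 3)| ≤ |g (σ ^ 3 * empDensity r x (x i))| + |g (σ ^ 3)| :=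
            abs_sub _ _
        _ ≤ Cg + Cg := add_le_add (hCg _ (mul_nonneg (by positivity) (hρ0 _ _))) (hCg _ (by positivity))
        _ ≤ ζ' + 2 * Cg := by linarith
    · rw [hDx]; dsimp only; rw [indicator_of_notMem hx, mul_zero, add_zero]
      exact hmod _ (hρ0 _ _) (abs_empDensity_sub_one_lt_of_not_mem hδ hr hx (x i))
  have hDx0 : ∀ x, 0 ≤ Dx x := fun x => add_nonneg hζ' (mul_nonneg (mul_nonneg zero_le_two hCg0)
    (indicator_nonneg (fun _ _ => zero_le_one) _))
  have hDx2 : ∀ x, Dx x ^ 2 ≤ 2 * ζ' ^ 2 + 8 * Cg ^ 2 * Bad.indicator (fun _ => (1 : ℝ)) x := fun x => by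
    by_cases hx : x ∈ Bad
    · rw [hDx]; dsimp only; rw [indicator_of_mem hx, mul_one, mul_one]; nlinarith [sq_nonneg (ζ' - 2 * Cg)]
    · rw [hDx]; dsimp only; rw [indicator_of_notMem hx, mul_zero, add_zero, mul_zero, add_zero]
      nlinarith [sq_nonneg ζ']
  -- the shell sum on the hard core
  have hMsum : ∀ p : (Fin (N + 1) → T3) × (Fin (N + 1) → V3), p.1 ∈ posDomain (hsDiameter σ N) (N + 1) →
      ∑ i, ∑ j, |M p i j| ≤ n * (2 * L * Cp) := by
    intro p hp
    calc ∑ i, ∑ j, |M p i j| ≤ ∑ i, 2 * L * shellCount σ N L κ (zipConfig p) i := by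
          refine Finset.sum_le_sum fun i _ => ?_
          calc ∑ j, |M p i j| ≤ ∑ j, 2 * L * shellInd σ N L κ (zipConfig p) i j :=
                Finset.sum_le_sum fun j _ => abs_tubeMark_le_shellInd hε k l hL.le hκ.le (zipConfig p) i j
            _ = 2 * L * shellCount σ N L κ (zipConfig p) i := by rw [shellCount, Finset.mul_sum]
      _ ≤ ∑ _i : Fin (N + 1), 2 * L * Cp := Finset.sum_le_sum fun i _ =>
          mul_le_mul_of_nonneg_left (shellCount_zipConfig_le_cube hε (mul_nonneg hL.le hκ.le) hp p.2 i) (by linarith)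
      _ = n * (2 * L * Cp) := by rw [Finset.sum_const, Finset.card_univ, Fintype.card_fin, nsmul_eq_mul]
  have hRpt : ∀ p : (Fin (N + 1) → T3) × (Fin (N + 1) → V3), p.1 ∈ posDomain (hsDiameter σ N) (N + 1) →
      |R p| ≤ 2 * L * Cχ * Cp / κ * Dx p.1 := by
    intro p hp
    rw [hReq p, abs_mul, abs_of_nonneg hc₀0]
    have hterm : ∀ i j, |(if i ≠ j then χ (t, p.1 i) * (g (σ ^ 3 * empDensity r p.1 (p.1 i)) - g (σ ^ 3)) * M p i j
        else 0)| ≤ Cχ * Dx p.1 * |M p i j| := fun i j => by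
      split_ifs
      · rw [abs_mul, abs_mul]
        exact mul_le_mul_of_nonneg_right (mul_le_mul (hχb _) (hDle p.1 i) (abs_nonneg _) hCχ.le) (abs_nonneg _)
      · rw [abs_zero]; exact mul_nonneg (mul_nonneg hCχ.le (hDx0 _)) (abs_nonneg _)
    calc c₀ * |∑ i, ∑ j, (if i ≠ j then χ (t, p.1 i) * (g (σ ^ 3 * empDensity r p.1 (p.1 i)) - g (σ ^ 3)) * M p i j
          else 0)| ≤ c₀ * ∑ i, ∑ j, Cχ * Dx p.1 * |M p i j| := by
          refine mul_le_mul_of_nonneg_left ((Finset.abs_sum_le_sum_abs _ _).trans (Finset.sum_le_sum fun i _ =>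
            (Finset.abs_sum_le_sum_abs _ _).trans (Finset.sum_le_sum fun j _ => hterm i j))) hc₀0
      _ = c₀ * (Cχ * Dx p.1 * ∑ i, ∑ j, |M p i j|) := by
          congr 1; rw [Finset.mul_sum]; exact Finset.sum_congr rfl fun i _ => by rw [Finset.mul_sum]
      _ ≤ c₀ * (Cχ * Dx p.1 * (n * (2 * L * Cp))) :=
          mul_le_mul_of_nonneg_left (mul_le_mul_of_nonneg_left (hMsum p hp) (mul_nonneg hCχ.le (hDx0 _))) hc₀0
      _ = 2 * L * Cχ * Cp / κ * Dx p.1 := by rw [hc₀]; field_simp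
  have hae : ∀ᵐ p ∂(P.prod Q), p.1 ∈ posDomain (hsDiameter σ N) (N + 1) := by
    rw [ae_iff]
    have hsub : {p : (Fin (N + 1) → T3) × (Fin (N + 1) → V3) | ¬p.1 ∈ posDomain (hsDiameter σ N) (N + 1)} ⊆
        (posDomain (hsDiameter σ N) (N + 1))ᶜ ×ˢ (univ : Set (Fin (N + 1) → V3)) := fun p hp => ⟨hp, mem_univ _⟩
    refine measure_mono_null hsub ?_
    rw [Measure.prod_prod, posGibbsMeasure_compl_posDomain, zero_mul]
  have hVarR : variance R (P.prod Q) ≤ (2 * L * Cχ * Cp / κ) ^ 2 * (2 * ζ' ^ 2 + 8 * Cg ^ 2 * P.real Bad) := by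
    have hbd : ∀ᵐ p ∂(P.prod Q), R p ^ 2 ≤
        (2 * L * Cχ * Cp / κ) ^ 2 * (2 * ζ' ^ 2 + 8 * Cg ^ 2 * Bad.indicator (fun _ => (1 : ℝ)) p.1) := by
      filter_upwards [hae] with p hp
      calc R p ^ 2 ≤ (2 * L * Cχ * Cp / κ * Dx p.1) ^ 2 := by
            rw [← sq_abs (R p)]; exact pow_le_pow_left₀ (abs_nonneg _) (hRpt p hp) 2
        _ = (2 * L * Cχ * Cp / κ) ^ 2 * Dx p.1 ^ 2 := by ring
        _ ≤ _ := mul_le_mul_of_nonneg_left (hDx2 p.1) (sq_nonneg _)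
    have hint : Integrable (fun p : (Fin (N + 1) → T3) × (Fin (N + 1) → V3) =>
        (2 * L * Cχ * Cp / κ) ^ 2 * (2 * ζ' ^ 2 + 8 * Cg ^ 2 * Bad.indicator (fun _ => (1 : ℝ)) p.1)) (P.prod Q) :=
      (((integrable_const _).add ((((integrable_const (1 : ℝ)).indicator hBadm).comp_fst Q).const_mul _)).const_mul _)
    calc variance R (P.prod Q) ≤ ∫ p, (R ^ 2) p ∂(P.prod Q) := variance_le_expectation_sq hRm.aestronglyMeasurable
      _ ≤ ∫ p, (2 * L * Cχ * Cp / κ) ^ 2 * (2 * ζ' ^ 2 + 8 * Cg ^ 2 * Bad.indicator (fun _ => (1 : ℝ)) p.1) ∂(P.prod Q) :=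
          integral_mono_of_nonneg (ae_of_all _ fun p => by simp only [Pi.pow_apply]; exact sq_nonneg _) hint
            (hbd.mono fun p hp => by simpa only [Pi.pow_apply] using hp)
      _ = (2 * L * Cχ * Cp / κ) ^ 2 * (2 * ζ' ^ 2 + 8 * Cg ^ 2 * P.real Bad) := by
          rw [integral_const_mul, integral_fun_fst (fun x => 2 * ζ' ^ 2 + 8 * Cg ^ 2 * Bad.indicator (fun _ => (1 : ℝ)) x),
            probReal_univ, one_smul, integral_add (integrable_const _) (((integrable_const (1 : ℝ)).indicator hBadm).const_mul _),
            integral_const, probReal_univ, one_smul, integral_const_mul, integral_indicator_const _ hBadm, smul_eq_mul, mul_one]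
  -- (4) the transfer and the arithmetic
  rw [variance_localGibbsLaw_rung0_eq σ ha hθ u N Φ (A := fun z => tubeStat σ N χ g Ξ r r 1 κ t z) hA'm]
  change variance A' (P.prod Q) ≤ _
  have hc₁ : c₁ ^ 2 ≤ (Cg * Cχ / κ) ^ 2 / n ^ 2 := by
    have h1 : |c₁| ≤ Cg * Cχ / (n * κ) := by
      rw [hc₁, abs_mul, abs_mul, abs_of_nonneg hc₀0, abs_of_pos hCχ, hc₀]
      calc (n * κ)⁻¹ * |g (σ ^ 3)| * Cχ ≤ (n * κ)⁻¹ * Cg * Cχ :=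
            mul_le_mul_of_nonneg_right (mul_le_mul_of_nonneg_left (hCg _ (by positivity)) (by positivity)) hCχ.le
        _ = Cg * Cχ / (n * κ) := by field_simp
    calc c₁ ^ 2 = |c₁| ^ 2 := (sq_abs _).symm
      _ ≤ (Cg * Cχ / (n * κ)) ^ 2 := pow_le_pow_left₀ (abs_nonneg _) h1 2
      _ = (Cg * Cχ / κ) ^ 2 / n ^ 2 := by field_simp
  have hVS0 := variance_nonneg S (P.prod Q)
  have he3 : n * (hsDiameter σ N) ^ 3 = σ ^ 3 := by rw [hn]; exact succ_mul_hsDiameter_pow_three σ N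
  have hkey : c₁ ^ 2 * variance S (P.prod Q) ≤ (Cg * Cχ / κ) ^ 2 *
      ((64 * L ^ 2 * Cp ^ 2 + 32 * (2 * L) ^ 2 * (4 / 3 * Real.pi * (1 + 2 * L * κ) ^ 3) * σ ^ 3 +
          192 * (2 * L) ^ 2 * (4 / 3 * Real.pi * (1 + 2 * L * κ) ^ 3) ^ 2 * σ ^ 6) / n +
        8 * ζ * (2 * L) ^ 2 * (4 / 3 * Real.pi * (1 + 2 * L * κ) ^ 3) ^ 2 * σ ^ 6) := by
    refine (mul_le_mul hc₁ hVarS hVS0 (by positivity)).trans (le_of_eq ?_)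
    rw [show σ ^ 6 = (σ ^ 3) ^ 2 by ring, ← he3, hCp]
    field_simp
    ring
  have hfin := hsplit.trans (add_le_add (mul_le_mul_of_nonneg_left hkey zero_le_two)
    (mul_le_mul_of_nonneg_left hVarR zero_le_two))
  rw [hn] at hfin
  linarith [hfin]

end Literature.MathematicalPhysics.KineticTheory

end
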